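import Summits.KontsevichZagierPeriods.KontsevichZagierPeriods.Theses.LiouvilleUnfolding
import Literature.NumberTheory.Transcendental.KZLogCalculus
import Literature.NumberTheory.Transcendental.KZKernelConjectureForms
import Literature.NumberTheory.Transcendental.KZCalculusProofs

/-!
# Crux `LiouvilleUnfolding.LogPrimitiveNL` (stmt-KontsevichZagierPeriods-2836): values, shape of a refutation, witness toolkit

Negative-side (cdisprove) support, file 1/3; the work file with the full discussion is
`Summits/KontsevichZagierPeriods/KontsevichZagierPeriods/Cruxes/LogPrimitiveNL/Disproof.lean`.

* §0 `crux_iff` — the crux literally (`Iff.rfl`), fixing the hypothesis names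
  `ha hb hab hdom hh hV hpos hcont hderiv hint hr hr'`.
* §1 `value_eq_of_logData`, `eval_sub_eq_zero_of_logData` — the ANALYTIC hypotheses alone
  (`hab hdom hpos hcont hderiv hr hr'`) force `r.value = r'.value` (Fubini + FTC with the
  transcendental primitive `Σ hᵢ log Vᵢ`, `KZlog.setIntegral_band_eq_of_hasDerivAt`).
* §2 hence refuting the crux refutes the kernel conjecture and the summit
  (`not_kzKernelConjecture_of_not`, `not_summit_of_not`); `not_of_separating_invariant` is the shape
  any refutation must take (an additive invariant of `KZ.FormalRep` finer than `KZ.eval`).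
* §3 toolkit for explicit data in dimension `0`/`1`: `ptRep q = [ℝ⁰, q]`, `band1 a b = [a, b] ⊂ ℝ¹`
  in the literal band shape of the crux over the point, `bandRep`, `setIntegral_band1_eq` (FTC),
  `value_eq_of_sub_mem_relations` (soundness).
-/

noncomputable section

open Set MeasureTheory
open Literature.NumberTheory.Transcendental

namespace Summit.KontsevichZagierPeriods.LiouvilleUnfolding.LogPrimitiveNL.Negative

open Summit.KontsevichZagierPeriods.KontsevichZagierPeriods.Theses.LiouvilleUnfolding (LogPrimitiveNL)

/-! ## §0 Read-back of the crux (literal, `Iff.rfl`) -/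

/-- The crux, literally (checked by `Iff.rfl`); hypotheses in order: `ha hb hab hdom hh hV hpos hcont
hderiv hint hr hr'`. -/
theorem crux_iff : LogPrimitiveNL ↔
    ∀ (n k : ℕ) (r : KZ.IntegralRep (n + 1)) (r' : KZ.IntegralRep n) (a b : (Fin n → ℝ) → ℝ)
    (h : Fin k → (Fin n → ℝ) → ℝ) (V V' : Fin k → (Fin (n + 1) → ℝ) → ℝ),
    IsSemialgebraicFunOn ℚ r'.domain a →
    IsSemialgebraicFunOn ℚ r'.domain b →
    (∀ x ∈ r'.domain, a x ≤ b x) →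
    r.domain = {z | (Fin.init z : Fin n → ℝ) ∈ r'.domain ∧ a (Fin.init z) ≤ z (Fin.last n) ∧
      z (Fin.last n) ≤ b (Fin.init z)} →
    (∀ i, IsSemialgebraicFunOn ℚ r'.domain (h i)) →
    (∀ i, IsSemialgebraicFunOn ℚ r.domain (V i)) →
    (∀ i, ∀ z ∈ r.domain, 0 < V i z) →
    (∀ i, ∀ x ∈ r'.domain, ContinuousOn (fun t : ℝ => V i (Fin.snoc x t)) (Icc (a x) (b x))) →
    (∀ i, ∀ x ∈ r'.domain, ∀ t ∈ Ioo (a x) (b x),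
      HasDerivAt (fun s : ℝ => V i (Fin.snoc x s)) (V' i (Fin.snoc x t)) t) →
    (∀ i, IntegrableOn (fun z => h i (Fin.init z) * V' i z / V i z) r.domain) →
    (∀ x ∈ r'.domain, ∀ t ∈ Ioo (a x) (b x),
      r.integrand (Fin.snoc x t) = ∑ i, h i x * V' i (Fin.snoc x t) / V i (Fin.snoc x t)) →
    (∀ x ∈ r'.domain, r'.integrand x =
      ∑ i, h i x * (Real.log (V i (Fin.snoc x (b x))) - Real.log (V i (Fin.snoc x (a x))))) →
    KZ.of r - KZ.of r' ∈ KZ.relations :=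
  Iff.rfl

/-! ## §1 Values: the hypotheses force `eval ([r] − [r']) = 0` -/

/-- Fibrewise membership in the band of the crux. -/
theorem snoc_mem_band_iff {n : ℕ} {τ : Set (Fin n → ℝ)} {a b : (Fin n → ℝ) → ℝ}
    {D : Set (Fin (n + 1) → ℝ)}
    (hdom : D = {z | (Fin.init z : Fin n → ℝ) ∈ τ ∧ a (Fin.init z) ≤ z (Fin.last n) ∧
      z (Fin.last n) ≤ b (Fin.init z)})
    {x : Fin n → ℝ} {t : ℝ} :
    (Fin.snoc x t : Fin (n + 1) → ℝ) ∈ D ↔ x ∈ τ ∧ t ∈ Icc (a x) (b x) := by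
  rw [hdom]
  exact KZlog.snoc_mem_band

/-- **Value equality (Fubini + FTC with the transcendental primitive `Σ hᵢ log Vᵢ`).** Under the
ANALYTIC hypotheses of the crux alone — `a ≤ b`, the band equation, `Vᵢ > 0`, continuity of `Vᵢ` on
closed fibres, the derivative `Vᵢ'` on open fibres, and the two integrand equations — the two
representations have the same value. No semialgebraicity of `a, b, hᵢ, Vᵢ` and no termwise
integrability is used (only `r.integrableOn`). -/
theorem value_eq_of_logData {n k : ℕ} (r : KZ.IntegralRep (n + 1)) (r' : KZ.IntegralRep n)
    (a b : (Fin n → ℝ) → ℝ) (h : Fin k → (Fin n → ℝ) → ℝ)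
    (V V' : Fin k → (Fin (n + 1) → ℝ) → ℝ)
    (hab : ∀ x ∈ r'.domain, a x ≤ b x)
    (hdom : r.domain = {z | (Fin.init z : Fin n → ℝ) ∈ r'.domain ∧ a (Fin.init z) ≤ z (Fin.last n) ∧
      z (Fin.last n) ≤ b (Fin.init z)})
    (hpos : ∀ i, ∀ z ∈ r.domain, 0 < V i z)
    (hcont : ∀ i, ∀ x ∈ r'.domain, ContinuousOn (fun t : ℝ => V i (Fin.snoc x t)) (Icc (a x) (b x)))
    (hderiv : ∀ i, ∀ x ∈ r'.domain, ∀ t ∈ Ioo (a x) (b x),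
      HasDerivAt (fun s : ℝ => V i (Fin.snoc x s)) (V' i (Fin.snoc x t)) t)
    (hr : ∀ x ∈ r'.domain, ∀ t ∈ Ioo (a x) (b x),
      r.integrand (Fin.snoc x t) = ∑ i, h i x * V' i (Fin.snoc x t) / V i (Fin.snoc x t))
    (hr' : ∀ x ∈ r'.domain, r'.integrand x =
      ∑ i, h i x * (Real.log (V i (Fin.snoc x (b x))) - Real.log (V i (Fin.snoc x (a x))))) :
    r.value = r'.value := by
  have hτ : MeasurableSet r'.domain := KZ.IntegralRep.measurableSet_domain_holds r'
  have hB : MeasurableSet (KZlog.band r'.domain a b) := by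
    have := KZ.IntegralRep.measurableSet_domain_holds r
    rwa [hdom] at this
  have hG : IntegrableOn r.integrand (KZlog.band r'.domain a b) := by
    have := r.integrableOn
    rwa [hdom] at this
  have hV0 : ∀ i, ∀ x ∈ r'.domain, ∀ t ∈ Icc (a x) (b x), V i (Fin.snoc x t) ≠ 0 :=
    fun i x hx t ht => (hpos i _ ((snoc_mem_band_iff hdom).2 ⟨hx, ht⟩)).ne'
  set F : (Fin (n + 1) → ℝ) → ℝ := fun z => ∑ i, h i (Fin.init z) * Real.log (V i z) with hF
  have key := KZlog.setIntegral_band_eq_of_hasDerivAt hτ hab hB hG (F := F) ?_ ?_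
  · unfold KZ.IntegralRep.value
    rw [hdom]
    change ∫ z in KZlog.band r'.domain a b, r.integrand z = _
    rw [key]
    refine setIntegral_congr_fun hτ fun x hx => ?_
    rw [hr' x hx]
    simp only [hF, Fin.init_snoc, ← Finset.sum_sub_distrib, mul_sub]
  · intro x hx
    simp only [hF, Fin.init_snoc]
    exact continuousOn_finsetSum _ fun i _ =>
      continuousOn_const.mul ((hcont i x hx).log (hV0 i x hx))
  · intro x hx t ht
    simp only [hF, Fin.init_snoc]
    have hd : HasDerivAt (fun s : ℝ => ∑ i, h i x * Real.log (V i (Fin.snoc x s)))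
        (∑ i, h i x * (V' i (Fin.snoc x t) / V i (Fin.snoc x t))) t :=
      HasDerivAt.fun_sum fun i _ =>
        (((hderiv i x hx t ht).log (hV0 i x hx t (Ioo_subset_Icc_self ht))).const_mul (h i x))
    rw [hr x hx t ht]
    convert hd using 2 with i
    ring

/-- `eval ([r] − [r']) = 0` for every instance of the crux's analytic data. -/
theorem eval_sub_eq_zero_of_logData {n k : ℕ} (r : KZ.IntegralRep (n + 1)) (r' : KZ.IntegralRep n)
    (a b : (Fin n → ℝ) → ℝ) (h : Fin k → (Fin n → ℝ) → ℝ)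
    (V V' : Fin k → (Fin (n + 1) → ℝ) → ℝ)
    (hab : ∀ x ∈ r'.domain, a x ≤ b x)
    (hdom : r.domain = {z | (Fin.init z : Fin n → ℝ) ∈ r'.domain ∧ a (Fin.init z) ≤ z (Fin.last n) ∧
      z (Fin.last n) ≤ b (Fin.init z)})
    (hpos : ∀ i, ∀ z ∈ r.domain, 0 < V i z)
    (hcont : ∀ i, ∀ x ∈ r'.domain, ContinuousOn (fun t : ℝ => V i (Fin.snoc x t)) (Icc (a x) (b x)))
    (hderiv : ∀ i, ∀ x ∈ r'.domain, ∀ t ∈ Ioo (a x) (b x),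
      HasDerivAt (fun s : ℝ => V i (Fin.snoc x s)) (V' i (Fin.snoc x t)) t)
    (hr : ∀ x ∈ r'.domain, ∀ t ∈ Ioo (a x) (b x),
      r.integrand (Fin.snoc x t) = ∑ i, h i x * V' i (Fin.snoc x t) / V i (Fin.snoc x t))
    (hr' : ∀ x ∈ r'.domain, r'.integrand x =
      ∑ i, h i x * (Real.log (V i (Fin.snoc x (b x))) - Real.log (V i (Fin.snoc x (a x))))) :
    KZ.eval (KZ.of r - KZ.of r') = 0 := by
  rw [KZ.eval_of_sub_of, value_eq_of_logData r r' a b h V V' hab hdom hpos hcont hderiv hr hr',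
    sub_self]

/-! ## §2 Shape of any refutation: the crux is a consequence of Conjecture 1 -/

/-- **A refutation of the crux refutes the kernel conjecture** `ker eval = relations`: the crux's
conclusion is membership of a KERNEL element (`eval_sub_eq_zero_of_logData`) in `relations`. -/
theorem not_kzKernelConjecture_of_not (hn : ¬ LogPrimitiveNL) : ¬ KZKernelConjecture := by
  intro hK
  apply hn
  intro n k r r' a b h V V' _ _ hab hdom _ _ hpos hcont hderiv _ hr hr'
  exact hK _ (eval_sub_eq_zero_of_logData r r' a b h V V' hab hdom hpos hcont hderiv hr hr')

/-- **A refutation of the crux refutes the summit** (Conjecture 1 as formalised), via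
`kzKernelConjecture_iff_isRational`: there is no refutation cheaper than a counterexample to the
period conjecture. -/
theorem not_summit_of_not (hn : ¬ LogPrimitiveNL) : ¬ _root_.KontsevichZagierPeriods :=
  fun hS => not_kzKernelConjecture_of_not hn (kzKernelConjecture_iff_isRational.mpr hS)

/-- TEMPLATE of a refutation: an additive invariant `J` vanishing on the four move sets together
with ONE logarithmic Newton–Leibniz datum on which `J [r] ≠ J [r']`. Soundness makes `KZ.eval`
such an invariant except for the last clause (`eval_sub_eq_zero_of_logData`): `J` must see more
than the value. No such `J` is known (it would be a "non-motivic" invariant of real periods). -/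
theorem not_of_separating_invariant {A : Type*} [AddCommGroup A] (J : KZ.FormalRep →+ A)
    (hJ : ∀ x ∈ KZ.domainAddRel ∪ KZ.integrandAddRel ∪ KZ.changeOfVariablesRel ∪ KZ.newtonLeibnizRel,
      J x = 0)
    {n k : ℕ} (r : KZ.IntegralRep (n + 1)) (r' : KZ.IntegralRep n)
    (a b : (Fin n → ℝ) → ℝ) (h : Fin k → (Fin n → ℝ) → ℝ)
    (V V' : Fin k → (Fin (n + 1) → ℝ) → ℝ)
    (ha : IsSemialgebraicFunOn ℚ r'.domain a) (hb : IsSemialgebraicFunOn ℚ r'.domain b)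
    (hab : ∀ x ∈ r'.domain, a x ≤ b x)
    (hdom : r.domain = {z | (Fin.init z : Fin n → ℝ) ∈ r'.domain ∧ a (Fin.init z) ≤ z (Fin.last n) ∧
      z (Fin.last n) ≤ b (Fin.init z)})
    (hh : ∀ i, IsSemialgebraicFunOn ℚ r'.domain (h i))
    (hV : ∀ i, IsSemialgebraicFunOn ℚ r.domain (V i))
    (hpos : ∀ i, ∀ z ∈ r.domain, 0 < V i z)
    (hcont : ∀ i, ∀ x ∈ r'.domain, ContinuousOn (fun t : ℝ => V i (Fin.snoc x t)) (Icc (a x) (b x)))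
    (hderiv : ∀ i, ∀ x ∈ r'.domain, ∀ t ∈ Ioo (a x) (b x),
      HasDerivAt (fun s : ℝ => V i (Fin.snoc x s)) (V' i (Fin.snoc x t)) t)
    (hint : ∀ i, IntegrableOn (fun z => h i (Fin.init z) * V' i z / V i z) r.domain)
    (hr : ∀ x ∈ r'.domain, ∀ t ∈ Ioo (a x) (b x),
      r.integrand (Fin.snoc x t) = ∑ i, h i x * V' i (Fin.snoc x t) / V i (Fin.snoc x t))
    (hr' : ∀ x ∈ r'.domain, r'.integrand x =
      ∑ i, h i x * (Real.log (V i (Fin.snoc x (b x))) - Real.log (V i (Fin.snoc x (a x)))))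
    (hJrr' : J (KZ.of r) ≠ J (KZ.of r')) :
    ¬ LogPrimitiveNL := by
  intro hc
  have hker : KZ.relations ≤ J.ker := (AddSubgroup.closure_le _).mpr fun x hx => hJ x hx
  have hmem := hker (hc n k r r' a b h V V' ha hb hab hdom hh hV hpos hcont hderiv hint hr hr')
  rw [AddMonoidHom.mem_ker, map_sub, sub_eq_zero] at hmem
  exact hJrr' hmem


/-! ## §3 Witness toolkit: the point `ℝ⁰`, bands `[a, b] ⊂ ℝ¹` over it -/

/-- Integration over `ℝ⁰` is evaluation at the point. -/
theorem integral_fin_zero (f : (Fin 0 → ℝ) → ℝ) : ∫ x, f x = f (fun i => i.elim0) := by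
  rw [volume_pi, Measure.pi_of_empty (fun _ => (volume : Measure ℝ)) (fun i => i.elim0),
    integral_dirac]

/-- Integration over `univ ⊆ ℝ⁰` is evaluation at the point. -/
theorem setIntegral_univ_fin_zero (f : (Fin 0 → ℝ) → ℝ) :
    ∫ x in (univ : Set (Fin 0 → ℝ)), f x = f (fun i => i.elim0) := by
  rw [Measure.restrict_univ, integral_fin_zero]

/-- Rational constants are `ℚ`-semialgebraic functions on any `ℚ`-semialgebraic set. -/
theorem isSemialgebraicFunOn_const {m : ℕ} {s : Set (Fin m → ℝ)}
    (hs : Literature.ModelTheory.ExponentialFields.IsSemialgebraic ℚ s) (q : ℚ) :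
    IsSemialgebraicFunOn ℚ s (fun _ => (q : ℝ)) :=
  (isSemialgebraicFunOn_aeval hs (MvPolynomial.C q)).congr fun x _ => by simp

/-- The constant representation `[ℝ⁰, q]` of a rational number `q` (dimension `0`). -/
def ptRep (q : ℚ) : KZ.IntegralRep 0 where
  domain := univ
  integrand := fun _ => (q : ℝ)
  isSemialgebraic_domain := Literature.ModelTheory.ExponentialFields.isSemialgebraic_univ
  isSemialgebraicFunOn_integrand :=
    isSemialgebraicFunOn_const Literature.ModelTheory.ExponentialFields.isSemialgebraic_univ q
  integrableOn := by
    have : IsFiniteMeasure (volume : Measure (Fin 0 → ℝ)) := by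
      rw [volume_pi, Measure.pi_of_empty]; infer_instance
    exact integrableOn_const

/-- The domain of `ptRep q` is the whole point. -/
@[simp] theorem domain_ptRep (q : ℚ) : (ptRep q).domain = univ := rfl

/-- The integrand of `ptRep q` is the constant `q`. -/
@[simp] theorem integrand_ptRep (q : ℚ) (x : Fin 0 → ℝ) : (ptRep q).integrand x = q := rfl

/-- `[ℝ⁰, q]` represents `q`. -/
@[simp] theorem value_ptRep (q : ℚ) : (ptRep q).value = q := by
  change ∫ _ in (univ : Set (Fin 0 → ℝ)), (q : ℝ) = q
  rw [setIntegral_univ_fin_zero]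

/-- The band `{z | init z ∈ ℝ⁰, a ≤ z₀ ≤ b} ⊂ ℝ¹` — LITERALLY the band shape of the crux over the
one-point base with constant edges (so that the band equation of the crux holds by `rfl`). -/
def band1 (a b : ℝ) : Set (Fin 1 → ℝ) :=
  {z | (Fin.init z : Fin 0 → ℝ) ∈ (univ : Set (Fin 0 → ℝ)) ∧ a ≤ z (Fin.last 0) ∧ z (Fin.last 0) ≤ b}

/-- Membership in `band1 a b`: `a ≤ z₀ ≤ b`. -/
@[simp] theorem mem_band1 {a b : ℝ} {z : Fin 1 → ℝ} : z ∈ band1 a b ↔ a ≤ z 0 ∧ z 0 ≤ b :=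
  ⟨fun h => ⟨h.2.1, h.2.2⟩, fun h => ⟨mem_univ _, h.1, h.2⟩⟩

/-- `band1 a b` is the box `[a, b]¹`. -/
theorem band1_eq_pi (a b : ℝ) : band1 a b = Set.pi univ fun _ => Icc a b := by
  ext z
  rw [mem_band1, Set.mem_univ_pi]
  simp only [Fin.forall_fin_one, mem_Icc]

/-- `band1 a b` is compact. -/
theorem isCompact_band1 (a b : ℝ) : IsCompact (band1 a b) := by
  rw [band1_eq_pi]
  exact isCompact_univ_pi fun _ => isCompact_Icc

/-- `band1 p q` is `ℚ`-semialgebraic for rational edges. -/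
theorem isSemialgebraic_band1 (p q : ℚ) :
    Literature.ModelTheory.ExponentialFields.IsSemialgebraic ℚ (band1 (p : ℝ) (q : ℝ)) :=
  KZlog.isSemialgebraic_band
    (isSemialgebraicFunOn_const Literature.ModelTheory.ExponentialFields.isSemialgebraic_univ p)
    (isSemialgebraicFunOn_const Literature.ModelTheory.ExponentialFields.isSemialgebraic_univ q)

/-- Fibrewise membership in `band1 a b` over the point. -/
theorem snoc_mem_band1 {a b : ℝ} {x : Fin 0 → ℝ} {t : ℝ} :
    (Fin.snoc x t : Fin 1 → ℝ) ∈ band1 a b ↔ t ∈ Icc a b := by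
  simp only [band1, mem_setOf_eq, mem_univ, true_and, Fin.snoc_last, mem_Icc]

/-- The value of a function on `ℝ¹` along the fibre over the point: `(snoc x t)₀ = t`. -/
@[simp] theorem snoc_fin_one_apply_zero (x : Fin 0 → ℝ) (t : ℝ) :
    (Fin.snoc x t : Fin 1 → ℝ) 0 = t := by
  rw [show (0 : Fin 1) = Fin.last 0 from rfl, Fin.snoc_last]

/-- A representation `[[a, b], G]` on a band over the point (dimension `1`), for a continuous
`ℚ`-semialgebraic integrand `G`. -/
def bandRep (a b : ℝ) (hs : Literature.ModelTheory.ExponentialFields.IsSemialgebraic ℚ (band1 a b))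
    (G : (Fin 1 → ℝ) → ℝ) (hG : IsSemialgebraicFunOn ℚ (band1 a b) G)
    (hGc : ContinuousOn G (band1 a b)) : KZ.IntegralRep 1 where
  domain := band1 a b
  integrand := G
  isSemialgebraic_domain := hs
  isSemialgebraicFunOn_integrand := hG
  integrableOn := hGc.integrableOn_compact (isCompact_band1 a b)

/-- The domain of `bandRep a b …` is `band1 a b`. -/
@[simp] theorem domain_bandRep (a b : ℝ) (hs) (G : (Fin 1 → ℝ) → ℝ) (hG) (hGc) :
    (bandRep a b hs G hG hGc).domain = band1 a b := rfl

/-- The integrand of `bandRep a b hs G …` is `G`. -/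
@[simp] theorem integrand_bandRep (a b : ℝ) (hs) (G : (Fin 1 → ℝ) → ℝ) (hG) (hGc) :
    (bandRep a b hs G hG hGc).integrand = G := rfl

/-- **FTC on a band over the point**: `∫_{[a,b]} G = f b − f a` for a primitive `f` of `G`
(continuous on `[a, b]`, derivative `G` inside), via `KZlog.setIntegral_band_eq_of_hasDerivAt` with
the one-point base. -/
theorem setIntegral_band1_eq {a b : ℝ} (hab : a ≤ b) {G : (Fin 1 → ℝ) → ℝ}
    (hG : IntegrableOn G (band1 a b)) {f : ℝ → ℝ} (hfc : ContinuousOn f (Icc a b))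
    (hfd : ∀ (x : Fin 0 → ℝ), ∀ t ∈ Ioo a b, HasDerivAt f (G (Fin.snoc x t)) t) :
    ∫ z in band1 a b, G z = f b - f a := by
  have hB : MeasurableSet (band1 a b) := (isCompact_band1 a b).isClosed.measurableSet
  have key := KZlog.setIntegral_band_eq_of_hasDerivAt (τ := (univ : Set (Fin 0 → ℝ)))
    (a := fun _ => a) (b := fun _ => b) MeasurableSet.univ (fun _ _ => hab) hB hG
    (F := fun z => f (z (Fin.last 0))) (fun x _ => by simpa only [Fin.snoc_last] using hfc)
    (fun x _ t ht => by simpa only [Fin.snoc_last] using hfd x t ht)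
  have e : (∫ z in band1 a b, G z) =
      ∫ z in KZlog.band (univ : Set (Fin 0 → ℝ)) (fun _ => a) (fun _ => b), G z := rfl
  rw [e, key, setIntegral_univ_fin_zero]
  simp only [Fin.snoc_last]

/-- Soundness, as used against every variant below: a relation has equal values at both ends. -/
theorem value_eq_of_sub_mem_relations {n m : ℕ} {r : KZ.IntegralRep n} {r' : KZ.IntegralRep m}
    (h : KZ.of r - KZ.of r' ∈ KZ.relations) : r.value = r'.value :=
  KZ.Equivalent.value_eq_holds h


end Summit.KontsevichZagierPeriods.LiouvilleUnfolding.LogPrimitiveNL.Negative
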